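import Literature.Analysis.OperatorTheory.Enflo2023.StepRealisationDiagN
import HarnessLib

/-!
# Enflo (2023), Part B — the orbit TREE of the Main Construction has FINITE DEPTH in the diagonal models:
a positive `εθ`-floor from every cyclic start, whatever produces the steps (`StepRealisation.DiagN`, policy-free form)

WHAT THIS FILE DECIDES.  `StepRealisationDiagN` refuted the orbit residual `IndepRunD` — the two-fold independence
(34) with one modulus `σ` at every state of the orbit tree `ReachD (ιS S) σ β s₀` — for every real diagonal `T_w` on
`ℂ^d` with simple spectrum `|w_i| ≤ τ ≤ σ/100`, from every admissible start whose run vector `y₀` has no vanishing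
eigen-coordinate.  In that proof (34) is used for ONE thing only: to PRODUCE the next orbit state
(`exists_state_stepκ`).  The two estimates that clash — the bracket bound `DiagN.phi_le` ((16): some scale-free
eigen-weight `Φ_i ≤ (εθ)²/(0.006075·γ)`) and the step bound `DiagN.phi_step` ((35)/(38): a commutant step of relative
size `≤ 2β/σ` changes every `Φ_i` by a factor `≤ (1 + 32βτ/σ)²` and kills no coordinate) — hold at EVERY state of the
tree and along EVERY admissible step.  This file records the policy-free consequence:

* `DiagN.reachD_weights` — along the whole orbit tree no eigen-coordinate of the run vector dies, and at depth `n`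
  (`(εθ) = (1−β)ⁿ(εθ)₀`, `ReachD.etheta_eq_pow`) every weight satisfies `min_i Φ_i(s₀) ≤ (1 + 32βτ/σ)²ⁿ · Φ_i`.
* `DiagN.reachD_etheta_floor` — **finite depth**: for every such `T_w`, unit `x₀`, `0 < σ ≤ 1`, `0 < β ≤ σ²/1000`
  and every true MC state `s₀` of an intertwiner with `(εθ)₀ > 0` and all eigen-coordinates of `y₀` non-zero (NO
  start margin is needed), there is `n₀` with `(1−β)^{n₀}(εθ)₀ ≤ (εθ)_s` for EVERY `s` in the orbit tree of `s₀`: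
  the schedule (45) `(εθ)' = (1−β)(εθ)` realised by steps `V ↦ V̂(1 + N)`, `N ∈ {S}'`, `‖N‖ ≤ 2β/σ` ((35)–(38)) with
  the drifts (41)/(43), can be followed fewer than `n₀` times — by (34) or by ANY other rule.
* `DiagN.no_scheduled_run` — hence no sequence of tree states `s_n` with `(εθ)_{s_n} = (1−β)ⁿ(εθ)₀` exists
  ("to arbitrarily small `(εθ)`'s", v2 p.19 l.677, is impossible here from a cyclic start).
* `StepRealisation.scheduledRun_of_indepRunD` (general `H`, `E`, `P`, `ι`) — what (34) is FOR: from an admissible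
  start with `(εθ)₀ > 0`, `IndepRunD` PRODUCES such a sequence (`exists_state_stepκ` at the self-pivot, iterated);
  so `DiagN.indepRunD_etheta_eq_zero` factors as `no_scheduled_run ∘ scheduledRun_of_indepRunD` (closing `example`).
* `DiagN.exists_floor_two` — non-vacuity (`d = 2`, `w = (τ, τ/2)`, the start of `Diag.exists_start_at`).

READING for the repair record (calibration, not a claim about the text's setting).  The typed residuals of the
record all have the shape "at every visited state an admissible continuation exists" (`IndepRunD` supplies it through
(34)); in these finite-dimensional models EVERY residual of that shape is false from a cyclic start, because the
tree itself is finite: what halts the Main Construction here is the coexistence of (16), (38) and (45) for `‖T‖ ≪ σ`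
in finite dimension, upstream of how the steps are chosen.  A derivation of (34) "to arbitrarily small `(εθ)`'s" in
the manuscript's setting must therefore use `dim H = ∞` / the absence of invariant subspaces at the point where
the orbit is CONTINUED, not merely where it is started.  Nothing is claimed for non-cyclic starts in `d ≥ 3`, for a
modulus `σ < 32‖T‖`, or for operators on infinite-dimensional spaces.  No new axioms; zero `sorry`; everything
model-specific is imported from `StepRealisationDiagN` by name.
-/

noncomputable section

open scoped InnerProductSpace ComplexConjugate ENNReal
open ContinuousLinearMap Filter Topology

namespace Literature.Analysis.OperatorTheory.Enflo2023

namespace StepRealisation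

open MCStep Vy

/-! ### (34) as the producer of the scheduled orbit (general setting) -/

section Producer

variable {E H : Type*} [NormedAddCommGroup E] [InnerProductSpace ℂ E] [CompleteSpace E]
  [NormedAddCommGroup H] [InnerProductSpace ℂ H] [CompleteSpace H]
variable {T : H →L[ℂ] H} {x₀ : H} {S : E →L[ℂ] E}
variable {P : Type*} [NormedAddCommGroup P] [NormedSpace ℝ P]

/-- **`IndepRunD` produces a scheduled run.**  In the general setting of `StepRealisationOrbit` (`‖x₀‖ = 1`,
directions `ι` real-homogeneous, contractive and commuting with `S`, `0 < σ ≤ 1`, `0 ≤ β ≤ σ²/1000`,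
start margin `0.09 + (22/σ + 1)(εθ)₀ ≤ ε₀² ≤ 0.49 − (22/σ + 1)(εθ)₀`, `(εθ)₀ > 0`): the orbit-level independence
hypothesis yields states `s_n` of the orbit tree with `(εθ)_{s_n} = (1−β)ⁿ(εθ)₀` for every `n` — at each `s_n` the
two-fold independence (34) at the self-pivot feeds `exists_state_stepκ` ((35)–(46)), whose output is the next tree
state.  This is the ONLY use the refutations make of (34). [cite: Enflo2023, v2 (34)–(46) p.16–19] -/
theorem scheduledRun_of_indepRunD [CompleteSpace P] {ι : P →+ (E →L[ℂ] E)} (hx₀ : ‖x₀‖ = 1)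
    (hιs : ∀ (t : ℝ) (p : P), ι (t • p) = (t : ℂ) • ι p) (hι1 : ∀ p, ‖ι p‖ ≤ ‖p‖)
    (hιS : ∀ p, ι p ∘L S = S ∘L ι p) {σ β : ℝ} (hσ : 0 < σ) (hσ1 : σ ≤ 1) (hβ0 : 0 ≤ β)
    (hβ : β ≤ σ ^ 2 / 1000) (s₀ : State T x₀ S) (he0 : 0 < s₀.etheta)
    (hstart : (0.09 : ℝ) + (22 / σ + 1) * s₀.etheta ≤ s₀.ε ^ 2 ∧
      s₀.ε ^ 2 + (22 / σ + 1) * s₀.etheta ≤ 0.49)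
    (h : IndepRunD T x₀ S ι σ β s₀) :
    ∃ f : ℕ → State T x₀ S, (∀ n, ReachD ι σ β s₀ (f n)) ∧ ∀ n, (f n).etheta = (1 - β) ^ n * s₀.etheta := by
  have hσ2 : σ ^ 2 ≤ σ := by nlinarith
  have hβ1 : β < 1 := by linarith
  set K : ℝ := 22 / σ + 1 with hK
  have hK0 : 0 ≤ K := by positivity
  have iter : ∀ n : ℕ, ∃ s : State T x₀ S, ReachD ι σ β s₀ s ∧ s.etheta = (1 - β) ^ n * s₀.etheta := by
    intro n
    induction n with
    | zero => exact ⟨s₀, ReachD.start, by rw [pow_zero, one_mul]⟩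
    | succ n ih =>
      obtain ⟨s, hs, hes⟩ := ih
      have he : 0 < s.etheta := by rw [hes]; exact mul_pos (pow_pos (by linarith) _) he0
      have hRs : |s.ε ^ 2 - s₀.ε ^ 2| ≤ K * (s₀.etheta - s.etheta) := hs.radInv
      have hab := abs_le.1 hRs
      have hβe : K * β * s.etheta ≤ K * s.etheta := by
        have h1 : β * s.etheta ≤ s.etheta := mul_le_of_le_one_left he.le hβ1.le
        have h2 := mul_le_mul_of_nonneg_left h1 hK0
        linarith [h2]
      have hlo : (0.09 : ℝ) + (22 / σ + 1) * β * s.etheta ≤ s.ε ^ 2 := by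
        rw [← hK]; linarith [hab.1, hstart.1]
      have hhi : s.ε ^ 2 + (22 / σ + 1) * β * s.etheta ≤ 0.49 := by
        rw [← hK]; linarith [hab.2, hstart.2]
      obtain ⟨s', h1, -, h3, h4, p, hp', hV'⟩ := exists_state_stepκ hιs hι1 hιS hx₀ s he hσ hσ1 hβ0
        hβ (x₀ - s.v) (h s s hs hs (invP_self' _ s _) he) hlo hhi
      exact ⟨s', hs.step he ⟨p, hp', hV'⟩ h1 h3 h4, by rw [h1, hes, pow_succ]; ring⟩
  choose f hf hfe using iter
  exact ⟨f, hf, hfe⟩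

end Producer

namespace DiagN

variable {d : ℕ} {w : Fin d → ℝ} {τ : ℝ} {x₀ : Cd d}

/-- **Weights along the orbit tree.**  From a start with all eigen-coordinates `cf s₀.V i ≠ 0` and
`p₀ ≤ Φ(s₀.V) i` for all `i`: every state `s` of the orbit tree `ReachD (ιS S) σ β s₀` has all `cf s.V i ≠ 0`,
and if `(εθ)_s = (1−β)ⁿ(εθ)₀` then `p₀ ≤ ((1 + 16(2β/σ)τ)²)ⁿ · Φ(s.V) i` for every `i` (`|w_i| ≤ τ ≤ ½`,
`2β/σ ≤ ½`, `0 < β < 1`, `(εθ)₀ > 0`).  Induction over the tree with `DiagN.phi_step`; the depth `n` is read off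
`(εθ)` because `(εθ)` drops by the factor `1 − β` EXACTLY at each step.
[cite: Enflo2023, v2 (35)–(38) p.16–17; (45) p.19] -/
theorem reachD_weights (hτ2 : τ ≤ 1 / 2) (hwτ : ∀ i, |w i| ≤ τ) (hx₀ : ‖x₀‖ = 1)
    {σ β : ℝ} (hβ0 : 0 < β) (hβ1 : β < 1) (hν : 2 * β / σ ≤ 1 / 2) (hν0 : 0 ≤ 2 * β / σ)
    (s₀ : State (TDg w) x₀ S) (he0 : 0 < s₀.etheta)
    {p₀ : ℝ} (hp : ∀ i, p₀ ≤ Φ s₀.V i) (hcyc : ∀ i, cf s₀.V i ≠ 0)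
    {s : State (TDg w) x₀ S} (hs : ReachD (ιS S) σ β s₀ s) :
    (∀ i, cf s.V i ≠ 0) ∧ ∀ n : ℕ, s.etheta = (1 - β) ^ n * s₀.etheta →
      ∀ i, p₀ ≤ ((1 + 16 * (2 * β / σ) * τ) ^ 2) ^ n * Φ s.V i := by
  obtain ⟨-, hι1, hιS⟩ := ιS_props (S : ℓ2 →L[ℂ] ℓ2)
  induction hs with
  | start =>
    refine ⟨hcyc, fun n _ i => ?_⟩
    have hτ0 : 0 ≤ τ := (abs_nonneg _).trans (hwτ i)
    have hρ1 : (1 : ℝ) ≤ ((1 + 16 * (2 * β / σ) * τ) ^ 2) ^ n := by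
      refine one_le_pow₀ (one_le_pow₀ ?_)
      have : 0 ≤ 16 * (2 * β / σ) * τ := by positivity
      linarith
    have hΦ0 : 0 ≤ Φ s₀.V i := div_nonneg (sq_nonneg _) (Finset.sum_nonneg fun j _ => sq_nonneg _)
    calc p₀ ≤ Φ s₀.V i := hp i
      _ = 1 * Φ s₀.V i := (one_mul _).symm
      _ ≤ ((1 + 16 * (2 * β / σ) * τ) ^ 2) ^ n * Φ s₀.V i := mul_le_mul_of_nonneg_right hρ1 hΦ0
  | @step s s' hs he hp' h1 _ _ ih =>
    obtain ⟨hc, hΦ⟩ := ih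
    obtain ⟨p, hpn, hV'⟩ := hp'
    have hN : ‖ιS S p‖ ≤ 2 * β / σ := (hι1 p).trans hpn
    obtain ⟨r, hr, hW⟩ := Wn_eq_smul hx₀ s he
    have hV'' : s'.V = r • (s.V ∘L (1 + ιS S p)) := by rw [hV', hW, smul_comp]
    obtain ⟨hc', hst⟩ := phi_step hτ2 hwτ (state_intertwine s) (hιS p) hN hν hc
    refine ⟨fun i => ?_, fun n hn i => ?_⟩
    · rw [hV'', cf_smul]
      exact mul_ne_zero ((map_ne_zero _).2 hr) (hc' i)
    · cases n with
      | zero =>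
        exfalso
        rw [pow_zero, one_mul] at hn
        have hle := hs.etheta_le hβ0.le hβ1.le he0.le
        nlinarith [mul_pos hβ0 he, mul_pos hβ0 he0]
      | succ m =>
        have h1b : (1 - β) ≠ 0 := (by linarith : (0 : ℝ) < 1 - β).ne'
        have hes : s.etheta = (1 - β) ^ m * s₀.etheta :=
          mul_left_cancel₀ h1b (by rw [← h1, hn, pow_succ]; ring)
        rw [hV'', Φ_smul hr, pow_succ, mul_assoc]
        exact (hΦ m hes i).trans (mul_le_mul_of_nonneg_left (hst i) (by positivity))

/-- **FINITE DEPTH OF THE ORBIT TREE (a positive `εθ`-floor).**  For every `d`, every real diagonal `T_w` on `ℂ^d`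
with distinct weights `|w_i| ≤ τ ≤ σ/100`, every unit `x₀`, `0 < σ ≤ 1`, `0 < β ≤ σ²/1000`, and every true MC
state `s₀` of an intertwiner (`V S = T_w V`) with `(εθ)₀ > 0` whose run vector has all eigen-coordinates non-zero
(`cf s₀.V i ≠ 0`; for simple spectrum: `y₀` cyclic), there is `n₀ : ℕ` such that EVERY state `s` of the orbit tree
`ReachD (ιS S) σ β s₀` — steps `V ↦ V̂(1 + N)`, `N ∈ {S}'`, `‖N‖ ≤ 2β/σ`, `(εθ)' = (1−β)(εθ)`, drifts (41)/(43),
produced by ANY rule — satisfies `(1−β)^{n₀}·(εθ)₀ ≤ (εθ)_s`.  No start margin is assumed.  Mechanism: at depth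
`n` the bracket bound `DiagN.phi_le` (at the bracket `V̂_s`, `‖V̂_s† v_s‖² = (εθ)_s`) and `DiagN.reachD_weights`
give `0.006075·γ·min_iΦ_i(s₀) ≤ ((1−β)²(1 + 32βτ/σ)²)ⁿ(εθ)₀²`, and `(1−β)(1 + 32βτ/σ) < 1` for `τ ≤ σ/100`.
[cite: Enflo2023, v2 (16) p.6; (34)–(38) p.16–17; (41), (43), (45) p.18–19; p.19 l.677] -/
theorem reachD_etheta_floor (hinj : Function.Injective w) (hwτ : ∀ i, |w i| ≤ τ) (hx₀ : ‖x₀‖ = 1)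
    {σ β : ℝ} (hσ : 0 < σ) (hσ1 : σ ≤ 1) (hτσ : τ ≤ σ / 100) (hβ0 : 0 < β) (hβ : β ≤ σ ^ 2 / 1000)
    (s₀ : State (TDg w) x₀ S) (he0 : 0 < s₀.etheta) (hcyc : ∀ i, cf s₀.V i ≠ 0) :
    ∃ n₀ : ℕ, ∀ s : State (TDg w) x₀ S, ReachD (ιS S) σ β s₀ s → (1 - β) ^ n₀ * s₀.etheta ≤ s.etheta := by
  have hS : ‖(S : ℓ2 →L[ℂ] ℓ2)‖ ≤ 1 := norm_S_le
  have hτ2 : τ ≤ 1 / 2 := by linarith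
  have hwh : ∀ i, |w i| ≤ 1 / 2 := fun i => (hwτ i).trans hτ2
  have hw : ∀ i, |w i| < 1 := fun i => by linarith [hwh i]
  have hg : ∀ i, ‖Diag.gv (w i)‖ ^ 2 ≤ 4 / 3 := fun i => norm_gv_sq_le (hwh i)
  have hσ2 : σ ^ 2 ≤ σ := by nlinarith
  have hβ1 : β < 1 := by linarith
  have hν : 2 * β / σ ≤ 1 / 2 := by
    rw [div_le_iff₀ hσ]; linarith
  have hν0 : 0 ≤ 2 * β / σ := by positivity
  obtain ⟨γ, hγ0, hγ⟩ := exists_frame hw hinj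
  -- `Fin d` is non-empty (`x₀ ≠ 0`), hence `0 ≤ τ` and a positive floor for the weights at the start
  have hne' : (Finset.univ : Finset (Fin d)).Nonempty := by
    by_contra h0
    rw [Finset.not_nonempty_iff_eq_empty] at h0
    have : ‖x₀‖ ^ 2 = 0 := by rw [EuclideanSpace.norm_sq_eq, h0, Finset.sum_empty]
    rw [hx₀] at this
    norm_num at this
  obtain ⟨i₀, -⟩ := hne'
  have hτ0 : 0 ≤ τ := (abs_nonneg _).trans (hwτ i₀)
  obtain ⟨p₀, hp₀, hp⟩ : ∃ p₀ : ℝ, 0 < p₀ ∧ ∀ i, p₀ ≤ Φ s₀.V i := by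
    obtain ⟨i, -, hi⟩ := Finset.exists_min_image Finset.univ (fun i => Φ s₀.V i) ⟨i₀, Finset.mem_univ i₀⟩
    refine ⟨Φ s₀.V i, ?_, fun j => hi j (Finset.mem_univ j)⟩
    have hA : 0 < ∑ j, ‖cf s₀.V j‖ ^ 2 :=
      Finset.sum_pos (fun j _ => pow_pos (norm_pos_iff.2 (hcyc j)) 2) ⟨i₀, Finset.mem_univ i₀⟩
    exact div_pos (pow_pos (norm_pos_iff.2 (hcyc i)) 2) hA
  set ρ : ℝ := (1 + 16 * (2 * β / σ) * τ) ^ 2 with hρ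
  -- closure: `(1−β)²ρ = ((1−β)(1 + 32βτ/σ))² < 1` since `32τ/σ ≤ 0.32 < 1`
  have hq0 : 0 ≤ (1 - β) * (1 + 16 * (2 * β / σ) * τ) := by
    have : 0 ≤ 16 * (2 * β / σ) * τ := by positivity
    nlinarith
  have hq1 : (1 - β) * (1 + 16 * (2 * β / σ) * τ) < 1 := by
    have h8 : 16 * (2 * β / σ) * τ ≤ 0.32 * β := by
      rw [show 16 * (2 * β / σ) * τ = β * (32 * τ / σ) by ring]
      have : 32 * τ / σ ≤ 0.32 := by rw [div_le_iff₀ hσ]; linarith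
      nlinarith
    nlinarith
  have hr0 : 0 ≤ (1 - β) ^ 2 * ρ := by positivity
  have hr1 : (1 - β) ^ 2 * ρ < 1 := by
    have e : (1 - β) ^ 2 * ρ = ((1 - β) * (1 + 16 * (2 * β / σ) * τ)) ^ 2 := by rw [hρ]; ring
    rw [e]
    exact pow_lt_one₀ hq0 hq1 two_ne_zero
  obtain ⟨n₀, hn₀⟩ := Diag.exists_pow_mul_lt (E := s₀.etheta ^ 2) hr0 hr1
    (by positivity : (0 : ℝ) < 0.006075 * γ * p₀)
  refine ⟨n₀, fun s hs => ?_⟩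
  obtain ⟨n, hes⟩ := hs.etheta_eq_pow
  obtain ⟨-, hΦ⟩ := reachD_weights hτ2 hwτ hx₀ hβ0 hβ1 hν hν0 s₀ he0 hp hcyc hs
  have hΦn := hΦ n hes
  have he : 0 < s.etheta := by rw [hes]; exact mul_pos (pow_pos (by linarith) _) he0
  -- the bracket bound at `s`
  have hbr : IsBracket (Wn s) x₀ s.v := isBracket_Wn hx₀ s he
  have hes' : ‖adjoint (Wn s) s.v‖ ^ 2 = s.etheta := by rw [etheta_eq_eth, eth_eq_of_isBracket hbr]
  obtain ⟨i, hb⟩ := phi_le hw hg hγ0 hγ (Wn_intertwine s) hbr (s.window hx₀).1 (norm_x₀_sub_v_ge hx₀ s)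
  obtain ⟨r, hr, hW⟩ := Wn_eq_smul hx₀ s he
  rw [hes', hes, hW, Φ_smul hr] at hb
  have hρn : 0 < ρ ^ n := by positivity
  have key : 0.006075 * γ * p₀ ≤ ((1 - β) ^ 2 * ρ) ^ n * s₀.etheta ^ 2 := by
    have h1 : 0.006075 * γ * p₀ ≤ ρ ^ n * (0.006075 * γ * Φ s.V i) := by
      have := mul_le_mul_of_nonneg_left (hΦn i) (by positivity : (0 : ℝ) ≤ 0.006075 * γ)
      rw [hρ]; linarith
    calc 0.006075 * γ * p₀ ≤ ρ ^ n * (0.006075 * γ * Φ s.V i) := h1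
      _ ≤ ρ ^ n * (((1 - β) ^ n * s₀.etheta) ^ 2) := mul_le_mul_of_nonneg_left hb hρn.le
      _ = ((1 - β) ^ 2 * ρ) ^ n * s₀.etheta ^ 2 := by
        have e2 : ((1 - β) ^ n * s₀.etheta) ^ 2 = ((1 - β) ^ 2) ^ n * s₀.etheta ^ 2 := by
          rw [mul_pow, ← pow_mul, ← pow_mul, mul_comm n 2]
        rw [e2, mul_pow]; ring
  have hlt : n < n₀ := by
    refine lt_of_not_ge fun hge => ?_
    have hmono : ((1 - β) ^ 2 * ρ) ^ n * s₀.etheta ^ 2 ≤ ((1 - β) ^ 2 * ρ) ^ n₀ * s₀.etheta ^ 2 :=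
      mul_le_mul_of_nonneg_right (pow_le_pow_of_le_one hr0 hr1.le hge) (sq_nonneg _)
    linarith [hn₀]
  rw [hes]
  exact mul_le_mul_of_nonneg_right (pow_le_pow_of_le_one (by linarith) (by linarith) hlt.le) he0.le

/-- **No scheduled run "to arbitrarily small `(εθ)`'s".**  Under the hypotheses of `DiagN.reachD_etheta_floor`
there is no sequence of orbit-tree states `s_n` with `(εθ)_{s_n} = (1−β)ⁿ(εθ)₀` for all `n` — in particular no
infinite chain of admissible steps, whatever rule selects them. [cite: Enflo2023, v2 (45) p.19; p.19 l.677] -/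
theorem no_scheduled_run (hinj : Function.Injective w) (hwτ : ∀ i, |w i| ≤ τ) (hx₀ : ‖x₀‖ = 1)
    {σ β : ℝ} (hσ : 0 < σ) (hσ1 : σ ≤ 1) (hτσ : τ ≤ σ / 100) (hβ0 : 0 < β) (hβ : β ≤ σ ^ 2 / 1000)
    (s₀ : State (TDg w) x₀ S) (he0 : 0 < s₀.etheta) (hcyc : ∀ i, cf s₀.V i ≠ 0) :
    ¬ ∃ f : ℕ → State (TDg w) x₀ S,
      (∀ n, ReachD (ιS S) σ β s₀ (f n)) ∧ ∀ n, (f n).etheta = (1 - β) ^ n * s₀.etheta := by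
  rintro ⟨f, hf, hfe⟩
  obtain ⟨n₀, hn₀⟩ := reachD_etheta_floor hinj hwτ hx₀ hσ hσ1 hτσ hβ0 hβ s₀ he0 hcyc
  have h1 := hn₀ (f (n₀ + 1)) (hf (n₀ + 1))
  rw [hfe (n₀ + 1), pow_succ] at h1
  have hσ2 : σ ^ 2 ≤ σ := by nlinarith
  have hβ1 : β < 1 := by linarith
  have hpos : 0 < (1 - β) ^ n₀ * s₀.etheta := mul_pos (pow_pos (by linarith) _) he0
  nlinarith

/-- The landed `DiagN.indepRunD_etheta_eq_zero`, factored: (34) produces the scheduled run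
(`scheduledRun_of_indepRunD`), the floor forbids it (`no_scheduled_run`).  An `example`, not a new declaration —
the statement is the landed one. [cite: Enflo2023, v2 (34) p.16; (45) p.19] -/
example (hinj : Function.Injective w) (hwτ : ∀ i, |w i| ≤ τ) (hx₀ : ‖x₀‖ = 1)
    {σ β : ℝ} (hσ : 0 < σ) (hσ1 : σ ≤ 1) (hτσ : τ ≤ σ / 100) (hβ0 : 0 < β) (hβ : β ≤ σ ^ 2 / 1000)
    (s₀ : State (TDg w) x₀ S)
    (hstart : (0.09 : ℝ) + (22 / σ + 1) * s₀.etheta ≤ s₀.ε ^ 2 ∧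
      s₀.ε ^ 2 + (22 / σ + 1) * s₀.etheta ≤ 0.49)
    (hcyc : ∀ i, cf s₀.V i ≠ 0) (h : IndepRunD (TDg w) x₀ S (ιS S) σ β s₀) : s₀.etheta = 0 := by
  obtain ⟨hιs, hι1, hιS⟩ := ιS_props (S : ℓ2 →L[ℂ] ℓ2)
  have hS : ‖(S : ℓ2 →L[ℂ] ℓ2)‖ ≤ 1 := norm_S_le
  by_contra hne
  have he0 : 0 < s₀.etheta := lt_of_le_of_ne (s₀.etheta_nonneg hx₀ hS) (Ne.symm hne)
  exact no_scheduled_run hinj hwτ hx₀ hσ hσ1 hτσ hβ0 hβ s₀ he0 hcyc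
    (scheduledRun_of_indepRunD hx₀ hιs hι1 hιS hσ hσ1 hβ0.le hβ s₀ he0 hstart h)

/-- **Non-vacuity (`d = 2`).**  For `w = (τ, τ/2)`, `0 < τ ≤ σ/100`, `0 < σ ≤ 1`, `0 < β ≤ σ²/1000`, the
start of `Diag.exists_start_at` is a true MC state with `(εθ)₀ > 0` and both eigen-coordinates non-zero, and its
orbit tree has a positive `εθ`-floor. [cite: Enflo2023, v2 (45) p.19; p.19 l.677] -/
theorem exists_floor_two {τ σ β : ℝ} (hτ : 0 < τ) (hσ : 0 < σ) (hσ1 : σ ≤ 1) (hτσ : τ ≤ σ / 100)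
    (hβ0 : 0 < β) (hβ : β ≤ σ ^ 2 / 1000) :
    ∃ (x₀ : Cd 2) (s₀ : State (TDg (Diag.wt τ)) x₀ S), ‖x₀‖ = 1 ∧ 0 < s₀.etheta ∧ (∀ i, cf s₀.V i ≠ 0) ∧
      ∃ n₀ : ℕ, ∀ s, ReachD (ιS S) σ β s₀ s → (1 - β) ^ n₀ * s₀.etheta ≤ s.etheta := by
  obtain ⟨x₀, s₀, hx₀, he, -, hc, -⟩ := not_indepRunD_two hτ hσ hσ1 hτσ hβ0 hβ
  have h01 : Diag.wt τ 0 ≠ Diag.wt τ 1 := by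
    rw [Diag.wt_zero, Diag.wt_one]; intro h; linarith
  have hinj : Function.Injective (Diag.wt τ) := by
    intro i j hij
    have key : ∀ a b : Fin 2, Diag.wt τ a = Diag.wt τ b → a = b :=
      Fin.forall_fin_two.2
        ⟨Fin.forall_fin_two.2 ⟨fun _ => rfl, fun h => absurd h h01⟩,
         Fin.forall_fin_two.2 ⟨fun h => absurd h.symm h01, fun _ => rfl⟩⟩
    exact key i j hij
  have hwτ : ∀ i, |Diag.wt τ i| ≤ τ :=
    Fin.forall_fin_two.2
      ⟨by rw [Diag.wt_zero, abs_of_pos hτ], by rw [Diag.wt_one, abs_of_pos (half_pos hτ)]; linarith⟩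
  exact ⟨x₀, s₀, hx₀, he, hc, reachD_etheta_floor hinj hwτ hx₀ hσ hσ1 hτσ hβ0 hβ s₀ he hc⟩

end DiagN

end StepRealisation

end Literature.Analysis.OperatorTheory.Enflo2023
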